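import Mathlib
import Literature.Computability.AlgebraicComplexity.BirkhoffShadowProofs
import HarnessLib

/-!
# Shadows of polytopes: the FACE LIFT (HY21 Lemma 10 in point form) — generic geometry, Theorems-side port

Port to `Theorems/` (director-valiant g12 R180 (b)(i): val-port-2 = S-port hand) of the GENERIC ingredients of
val-idea-7 g7's kernel-checked line workfile `Cruxes/NNLinearDegreeCofactorHard/Lines/shadow_division.lean` rev 5b
(§ FaceLiftGeo), verbatim bodies, with the line's local `UM[c,d,X]` notation SPELLED OUT as the set of points of `X`
UNIQUELY MAXIMISED by some member `c + t·d` of a pencil of homogeneous additive functionals,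
`{p | p ∈ X ∧ ∃ t : ℝ, ∀ q ∈ X, q ≠ p → c q + t * d q < c p + t * d p}`, and no definitions.

Contents (all over a general real vector space unless the plane `Fin 2 → ℝ` is named):
* `mem_extremePoints_of_strict_max` — a point of `X` strictly maximising a linear functional over `X ∖ {p}` is an
  extreme point of `conv X` [folklore: exposed ⇒ extreme]; `um_subset_extremePoints` — uniquely maximised points of a
  homogeneous pencil are extreme points.
* `exists_pencil_of_many_vertices` — by HY21 Prop 23's four coordinate pencils
  (`Literature…HrubesYehudayoff2021Prop23.extremePoints_subset_um4`, consumed BY NAME), a planar point set with `> 4B`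
  hull vertices has a coordinate pencil uniquely maximised at `> B` points.
* `exists_face_gap` — a valid inequality on a finite point set has a positive gap off its face (the companion
  `convexHull_inter_face` — the face it cuts out of the hull is the hull of the points on it — is in the sibling file).
* ★ `um_lift_face` — THE FACE LIFT [HrubesYehudayoff2021, Lemma 10 p.7, point form, valid-inequality version]: for a
  finite `S`, an inequality `w ≤ w₀` valid on `S` with gap `γ`, a linear read-out `ρ` taking the face points exactly onto
  `Y`, a planar shadow map `Λ` and a pencil `(c,d)` with a vector `e`, `c e = 1`, `d e = 0`, the linear map
  `L := Λ ∘ ρ + (K·w) • e` carries a translate of the uniquely-maximised set of `Λ(Y)` into that of `L(S)` — loss-free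
  per pencil; `um_lift` = the coordinate-face special case (`ψ ∈ {0} ∪ [1,∞)` on `S`).
* `ncard_um_le_shadow_lift`, `shadow_faceLift_count`, ★ `shadow_faceLift_count_face` — vertex currency: if the shadow
  `Λ(Y)` of the face read-out has more than `4·B` vertices, some planar shadow of `S` has more than `B`.

Consumers: the line's T2 (`faceLift`, coordinate face of `NFP_n`) and G♭ ⇒ G (`gridCorShadowHard_of_cliqueFace`, the AFHMS
clique face of `COR(G_{t,t})`, sibling file).  HONEST FRAMING: helper/port layer of an OPEN line (inputs A1
`QueueGridZeroOnePoints` and G♭ `Theses.FifoMatching.GridCorCliqueFace` = stmt-27045 are OPEN; K1 stmt-26254 is closed only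
conditionally); nothing here moves a rung of record or bears on `VP ≠ VNP`, which is NOT proved.

Source: P. Hrubeš, A. Yehudayoff, Shadows of Newton polytopes, CCC 2021 / Israel J. Math. 256 (2023) [HrubesYehudayoff2021:
Lemma 10/11/12 p.7, Prop 22/23 pp.10–11].
-/

set_option autoImplicit false

-- the mandated summit-side namespace repeats a component by design (single-problem summit)
set_option linter.dupNamespace false

open Literature.Computability.AlgebraicComplexity

namespace Summit.ValiantsHypothesis.ValiantsHypothesis.Theorems.FifoMatching

namespace GridCorShadow

variable {G : Type*} [AddCommGroup G] [Module ℝ G]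

/-- **Uniquely maximised ⇒ extreme.** If `p ∈ X` strictly maximises the linear functional `g` over `X ∖ {p}`,
then `p` is an extreme point of `conv X`. [folklore: exposed points are extreme] -/
theorem mem_extremePoints_of_strict_max (X : Set G) (g : G →ₗ[ℝ] ℝ) {p : G} (hp : p ∈ X)
    (hmax : ∀ q ∈ X, q ≠ p → g q < g p) :
    p ∈ Set.extremePoints ℝ (convexHull ℝ X) := by
  classical
  -- every point of `conv X` has `g ≤ g p`, with equality only at `p`
  have hle : ∀ q ∈ X, g q ≤ g p := fun q hq => by
    by_cases h : q = p
    · rw [h]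
    · exact (hmax q hq h).le
  have key : ∀ x ∈ convexHull ℝ X, g x ≤ g p ∧ (g x = g p → x = p) := by
    intro x hx
    rw [_root_.convexHull_eq] at hx
    obtain ⟨κ, t, w, z, hw0, hw1, hz, rfl⟩ := hx
    have hcm : t.centerMass w z = ∑ i ∈ t, w i • z i := Finset.centerMass_eq_of_sum_1 _ _ hw1
    have hg : g (t.centerMass w z) = ∑ i ∈ t, w i * g (z i) := by
      rw [hcm, map_sum]
      simp [map_smul, smul_eq_mul]
    have hsum_le : ∑ i ∈ t, w i * g (z i) ≤ ∑ i ∈ t, w i * g p :=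
      Finset.sum_le_sum fun i hi => mul_le_mul_of_nonneg_left (hle _ (hz i hi)) (hw0 i hi)
    have hsum_p : ∑ i ∈ t, w i * g p = g p := by rw [← Finset.sum_mul, hw1, one_mul]
    refine ⟨by rw [hg]; linarith, fun heq => ?_⟩
    -- equality: every `z i` with positive weight is `p`
    have hzero : ∀ i ∈ t, w i ≠ 0 → z i = p := by
      intro i hi hwi
      by_contra hne
      have hlt : w i * g (z i) < w i * g p :=
        mul_lt_mul_of_pos_left (hmax _ (hz i hi) hne) (lt_of_le_of_ne (hw0 i hi) (Ne.symm hwi))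
      have : ∑ j ∈ t, w j * g (z j) < ∑ j ∈ t, w j * g p :=
        Finset.sum_lt_sum (fun j hj => mul_le_mul_of_nonneg_left (hle _ (hz j hj)) (hw0 j hj)) ⟨i, hi, hlt⟩
      rw [hg] at heq
      linarith
    rw [← Finset.centerMass_filter_ne_zero]
    have hw1' : ∑ i ∈ t.filter (fun i => w i ≠ 0), w i = 1 := by rw [Finset.sum_filter_ne_zero, hw1]
    rw [Finset.centerMass_eq_of_sum_1 _ _ hw1']
    calc ∑ i ∈ t.filter (fun i => w i ≠ 0), w i • z i
        = ∑ i ∈ t.filter (fun i => w i ≠ 0), w i • p := by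
          refine Finset.sum_congr rfl fun i hi => ?_
          obtain ⟨hit, hwi⟩ := Finset.mem_filter.mp hi
          rw [hzero i hit hwi]
      _ = p := by rw [← Finset.sum_smul, hw1', one_smul]
  rw [mem_extremePoints]
  refine ⟨subset_convexHull ℝ X hp, fun x₁ hx₁ x₂ hx₂ hseg => ?_⟩
  obtain ⟨a, b, ha, hb, hab, hpx⟩ := hseg
  have h1 := key x₁ hx₁
  have h2 := key x₂ hx₂
  have hgp : g p = a * g x₁ + b * g x₂ := by
    rw [← hpx, map_add, map_smul, map_smul, smul_eq_mul, smul_eq_mul]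
  have hsum : a * (g p - g x₁) + b * (g p - g x₂) = 0 := by linear_combination (g p) * hab + hgp
  have t1 : 0 ≤ a * (g p - g x₁) := mul_nonneg ha.le (by linarith [h1.1])
  have t2 : 0 ≤ b * (g p - g x₂) := mul_nonneg hb.le (by linarith [h2.1])
  have z1 : a * (g p - g x₁) = 0 := by linarith
  have z2 : b * (g p - g x₂) = 0 := by linarith
  have e1 : g x₁ = g p := by
    have := (mul_eq_zero.1 z1).resolve_left ha.ne'
    linarith
  have e2 : g x₂ = g p := by
    have := (mul_eq_zero.1 z2).resolve_left hb.ne'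
    linarith
  exact ⟨h1.2 e1, h2.2 e2⟩

/-- uniquely maximised points of a homogeneous pencil are extreme points of the hull. -/
theorem um_subset_extremePoints (X : Set G) (c d : G →+ ℝ)
    (hc : ∀ (a : ℝ) (x : G), c (a • x) = a * c x) (hd : ∀ (a : ℝ) (x : G), d (a • x) = a * d x) :
    {p | p ∈ X ∧ ∃ t : ℝ, ∀ q ∈ X, q ≠ p → c q + t * d q < c p + t * d p} ⊆ Set.extremePoints ℝ (convexHull ℝ X) := by
  rintro p ⟨hp, t, ht⟩
  -- the pencil member `c + t·d` as a linear functional (proof-local structure, no declaration)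
  let g : G →ₗ[ℝ] ℝ :=
    { toFun := fun x => c x + t * d x
      map_add' := fun x y => by rw [map_add, map_add]; ring
      map_smul' := fun a x => by rw [hc, hd, RingHom.id_apply, smul_eq_mul]; ring }
  exact mem_extremePoints_of_strict_max X g hp fun q hq hne => ht q hq hne

/-- the four coordinate pencils cover the vertices: some pencil is uniquely maximised at `> B` points
whenever there are `> 4 B` vertices. -/
theorem exists_pencil_of_many_vertices (T : Set (Fin 2 → ℝ)) (hT : T.Finite) (B : ℕ)
    (hB : 4 * B < (Set.extremePoints ℝ (convexHull ℝ T)).ncard) :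
    ∃ (c d : (Fin 2 → ℝ) →+ ℝ) (e : Fin 2 → ℝ),
      (∀ (a : ℝ) (x : Fin 2 → ℝ), c (a • x) = a * c x) ∧ (∀ (a : ℝ) (x : Fin 2 → ℝ), d (a • x) = a * d x) ∧
      c e = 1 ∧ d e = 0 ∧ B < ({p | p ∈ T ∧ ∃ t : ℝ, ∀ q ∈ T, q ≠ p → c q + t * d q < c p + t * d p}).ncard := by
  classical
  let c₀ : (Fin 2 → ℝ) →+ ℝ := Pi.evalAddMonoidHom (fun _ : Fin 2 => ℝ) 0
  let c₁ : (Fin 2 → ℝ) →+ ℝ := Pi.evalAddMonoidHom (fun _ : Fin 2 => ℝ) 1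
  have hc₀ : ∀ x, c₀ x = x 0 := fun x => rfl
  have hc₁ : ∀ x, c₁ x = x 1 := fun x => rfl
  have h4 := HrubesYehudayoff2021Prop23.extremePoints_subset_um4 c₀ c₁ hc₀ hc₁ T hT
  -- finiteness of the four UM sets
  have hf : ∀ (c d : (Fin 2 → ℝ) →+ ℝ), ({p | p ∈ T ∧ ∃ t : ℝ, ∀ q ∈ T, q ≠ p → c q + t * d q < c p + t * d p}).Finite := fun c d => hT.subset fun p hp => hp.1
  have hsum : (Set.extremePoints ℝ (convexHull ℝ T)).ncard ≤
      ({p | p ∈ T ∧ ∃ t : ℝ, ∀ q ∈ T, q ≠ p → c₀ q + t * c₁ q < c₀ p + t * c₁ p}).ncard + ({p | p ∈ T ∧ ∃ t : ℝ, ∀ q ∈ T, q ≠ p → (-c₀) q + t * c₁ q < (-c₀) p + t * c₁ p}).ncard + ({p | p ∈ T ∧ ∃ t : ℝ, ∀ q ∈ T, q ≠ p → c₁ q + t * c₀ q < c₁ p + t * c₀ p}).ncard + ({p | p ∈ T ∧ ∃ t : ℝ, ∀ q ∈ T, q ≠ p → (-c₁) q + t * c₀ q < (-c₁) p + t * c₀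 p}).ncard := by
    calc (Set.extremePoints ℝ (convexHull ℝ T)).ncard
        ≤ ({p | p ∈ T ∧ ∃ t : ℝ, ∀ q ∈ T, q ≠ p → c₀ q + t * c₁ q < c₀ p + t * c₁ p} ∪ {p | p ∈ T ∧ ∃ t : ℝ, ∀ q ∈ T, q ≠ p → (-c₀) q + t * c₁ q < (-c₀) p + t * c₁ p} ∪ {p | p ∈ T ∧ ∃ t : ℝ, ∀ q ∈ T, q ≠ p → c₁ q + t * c₀ q < c₁ p + t * c₀ p} ∪ {p | p ∈ T ∧ ∃ t : ℝ, ∀ q ∈ T, q ≠ p → (-c₁) q + t * c₀ q < (-c₁) p + t * c₀ p}).ncard :=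
          Set.ncard_le_ncard h4 ((((hf _ _).union (hf _ _)).union (hf _ _)).union (hf _ _))
      _ ≤ ({p | p ∈ T ∧ ∃ t : ℝ, ∀ q ∈ T, q ≠ p → c₀ q + t * c₁ q < c₀ p + t * c₁ p} ∪ {p | p ∈ T ∧ ∃ t : ℝ, ∀ q ∈ T, q ≠ p → (-c₀) q + t * c₁ q < (-c₀) p + t * c₁ p} ∪ {p | p ∈ T ∧ ∃ t : ℝ, ∀ q ∈ T, q ≠ p → c₁ q + t * c₀ q < c₁ p + t * c₀ p}).ncard + ({p | p ∈ T ∧ ∃ t : ℝ, ∀ q ∈ T, q ≠ p → (-c₁) q + t * c₀ q < (-c₁) p + t * c₀ p}).ncard :=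
          Set.ncard_union_le _ _
      _ ≤ ({p | p ∈ T ∧ ∃ t : ℝ, ∀ q ∈ T, q ≠ p → c₀ q + t * c₁ q < c₀ p + t * c₁ p} ∪ {p | p ∈ T ∧ ∃ t : ℝ, ∀ q ∈ T, q ≠ p → (-c₀) q + t * c₁ q < (-c₀) p + t * c₁ p}).ncard + ({p | p ∈ T ∧ ∃ t : ℝ, ∀ q ∈ T, q ≠ p → c₁ q + t * c₀ q < c₁ p + t * c₀ p}).ncard + ({p | p ∈ T ∧ ∃ t : ℝ, ∀ q ∈ T, q ≠ p → (-c₁) q + t * c₀ q < (-c₁) p + t * c₀ p}).ncard := by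
          gcongr; exact Set.ncard_union_le _ _
      _ ≤ _ := by gcongr; exact Set.ncard_union_le _ _
  -- homogeneity of (±) coordinate functionals
  have hom₀ : ∀ (a : ℝ) (x : Fin 2 → ℝ), c₀ (a • x) = a * c₀ x := fun a x => by simp [hc₀]
  have hom₁ : ∀ (a : ℝ) (x : Fin 2 → ℝ), c₁ (a • x) = a * c₁ x := fun a x => by simp [hc₁]
  have homn₀ : ∀ (a : ℝ) (x : Fin 2 → ℝ), (-c₀) (a • x) = a * (-c₀) x := fun a x => by
    simp [hc₀]
  have homn₁ : ∀ (a : ℝ) (x : Fin 2 → ℝ), (-c₁) (a • x) = a * (-c₁) x := fun a x => by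
    simp [hc₁]
  -- the four unit vectors
  let e₀ : Fin 2 → ℝ := Pi.single 0 1
  let e₁ : Fin 2 → ℝ := Pi.single 1 1
  by_cases h1 : B < ({p | p ∈ T ∧ ∃ t : ℝ, ∀ q ∈ T, q ≠ p → c₀ q + t * c₁ q < c₀ p + t * c₁ p}).ncard
  · exact ⟨c₀, c₁, e₀, hom₀, hom₁, by simp [hc₀, e₀], by simp [hc₁, e₀], h1⟩
  by_cases h2 : B < ({p | p ∈ T ∧ ∃ t : ℝ, ∀ q ∈ T, q ≠ p → (-c₀) q + t * c₁ q < (-c₀) p + t * c₁ p}).ncard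
  · exact ⟨-c₀, c₁, -e₀, homn₀, hom₁, by simp [hc₀, e₀], by simp [hc₁, e₀], h2⟩
  by_cases h3 : B < ({p | p ∈ T ∧ ∃ t : ℝ, ∀ q ∈ T, q ≠ p → c₁ q + t * c₀ q < c₁ p + t * c₀ p}).ncard
  · exact ⟨c₁, c₀, e₁, hom₁, hom₀, by simp [hc₁, e₁], by simp [hc₀, e₁], h3⟩
  by_cases h4' : B < ({p | p ∈ T ∧ ∃ t : ℝ, ∀ q ∈ T, q ≠ p → (-c₁) q + t * c₀ q < (-c₁) p + t * c₀ p}).ncard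
  · exact ⟨-c₁, c₀, -e₁, homn₁, hom₀, by simp [hc₁, e₁], by simp [hc₀, e₁], h4'⟩
  omega

/-- a valid inequality on a finite point set has a positive gap off its face. -/
theorem exists_face_gap {E : Type*} [AddCommGroup E] [Module ℝ E] (S : Set E) (hS : S.Finite)
    (w : E →ₗ[ℝ] ℝ) (w₀ : ℝ) (hvalid : ∀ x ∈ S, w x ≤ w₀) :
    ∃ γ : ℝ, 0 < γ ∧ ∀ x ∈ S, w x = w₀ ∨ w x + γ ≤ w₀ := by
  classical
  let D : Finset ℝ := (hS.toFinset.image fun x => w₀ - w x).filter fun a => 0 < a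
  by_cases hD : D.Nonempty
  · refine ⟨D.min' hD, ?_, fun x hx => ?_⟩
    · have := D.min'_mem hD
      exact (Finset.mem_filter.1 this).2
    · rcases (hvalid x hx).lt_or_eq with hlt | heq
      · right
        have hmem : w₀ - w x ∈ D :=
          Finset.mem_filter.2 ⟨Finset.mem_image.2 ⟨x, hS.mem_toFinset.2 hx, rfl⟩, by linarith⟩
        have := D.min'_le _ hmem
        linarith
      · exact Or.inl heq
  · refine ⟨1, one_pos, fun x hx => ?_⟩
    rcases (hvalid x hx).lt_or_eq with hlt | heq
    · exact absurd ⟨w₀ - w x, Finset.mem_filter.2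
        ⟨Finset.mem_image.2 ⟨x, hS.mem_toFinset.2 hx, rfl⟩, by linarith⟩⟩ hD
    · exact Or.inl heq

/-- **The face lift** (HY21 Lemma 10 in point form, loss-free for a fixed pencil; valid-inequality version).  `S` a finite
point set in a real vector space `E`; `w x ≤ w₀` an inequality on `S` with a gap `γ > 0` off its face (automatic for finite `S`,
`exists_face_gap`); `ρ : E → F` a linear read-out taking the face points `S ∩ {w = w₀}` exactly onto `Y`; `Λ` a planar shadow
map of `F`; `(c,d)` a homogeneous pencil with a vector `e`, `c e = 1`, `d e = 0`.  Then the LINEAR map `L := Λ ∘ ρ + (K·w) • e`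
(suitable `K`) carries a translate of `{p | p ∈ Λ(Y) ∧ ∃ t : ℝ, ∀ q ∈ Λ(Y), q ≠ p → c q + t * d q < c p + t * d p}` into `{p | p ∈ L(S) ∧ ∃ t : ℝ, ∀ q ∈ L(S), q ≠ p → c q + t * d q < c p + t * d p}`: every uniquely maximised point of the face shadow
stays uniquely maximised (off-face points are pushed below by `K γ`).  Reused for T2 (coordinate face of `NFP_n`) and for
G♭ ⇒ G (the AFHMS clique face of `COR(G_{t,t})`). -/
theorem um_lift_face {E F : Type*} [AddCommGroup E] [Module ℝ E] [AddCommGroup F] [Module ℝ F]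
    (S : Set E) (hS : S.Finite) (w : E →ₗ[ℝ] ℝ) (w₀ γ : ℝ) (hγ : 0 < γ)
    (hwS : ∀ x ∈ S, w x = w₀ ∨ w x + γ ≤ w₀)
    (ρ : E →ₗ[ℝ] F) (Y : Set F) (hY : ρ '' (S ∩ {x | w x = w₀}) = Y)
    (Λ : F →ₗ[ℝ] (Fin 2 → ℝ)) (c d : (Fin 2 → ℝ) →+ ℝ)
    (hc : ∀ (a : ℝ) (x : Fin 2 → ℝ), c (a • x) = a * c x) (hd : ∀ (a : ℝ) (x : Fin 2 → ℝ), d (a • x) = a * d x)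
    (e : Fin 2 → ℝ) (hce : c e = 1) (hde : d e = 0) :
    ∃ (L : E →ₗ[ℝ] (Fin 2 → ℝ)) (v : Fin 2 → ℝ), (fun p => p + v) '' {p | p ∈ Λ '' Y ∧ ∃ t : ℝ, ∀ q ∈ Λ '' Y, q ≠ p → c q + t * d q < c p + t * d p} ⊆ {p | p ∈ L '' S ∧ ∃ t : ℝ, ∀ q ∈ L '' S, q ≠ p → c q + t * d q < c p + t * d p} := by
  classical
  have hw1 : ∀ x ∈ S, ¬ w x = w₀ → w x + γ ≤ w₀ := fun x hx h => (hwS x hx).resolve_left h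
  -- witnesses and the constant `K`
  set U : Set (Fin 2 → ℝ) := {p | p ∈ Λ '' Y ∧ ∃ t : ℝ, ∀ q ∈ Λ '' Y, q ≠ p → c q + t * d q < c p + t * d p} with hU
  have hYfin : Y.Finite := by rw [← hY]; exact (hS.subset Set.inter_subset_left).image _
  have hUfin : U.Finite := (hYfin.image Λ).subset fun p hp => hp.1
  let τ : (Fin 2 → ℝ) → ℝ := fun p => if h : p ∈ U then h.2.choose else 0
  have hτ : ∀ p ∈ U, ∀ q ∈ Λ '' Y, q ≠ p → c q + τ p * d q < c p + τ p * d p := by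
    intro p hp
    have := hp.2.choose_spec
    simp only [τ, dif_pos hp]
    exact this
  let B : ℝ := ∑ p ∈ hUfin.toFinset, ∑ x ∈ hS.toFinset,
    |c (Λ (ρ x)) + τ p * d (Λ (ρ x)) - (c p + τ p * d p)|
  have hB0 : 0 ≤ B := Finset.sum_nonneg fun p _ => Finset.sum_nonneg fun x _ => abs_nonneg _
  have hBbound : ∀ p ∈ U, ∀ x ∈ S,
      c (Λ (ρ x)) + τ p * d (Λ (ρ x)) - (c p + τ p * d p) ≤ B := by
    intro p hp x hx
    have h1 : |c (Λ (ρ x)) + τ p * d (Λ (ρ x)) - (c p + τ p * d p)| ≤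
        ∑ x ∈ hS.toFinset, |c (Λ (ρ x)) + τ p * d (Λ (ρ x)) - (c p + τ p * d p)| :=
      Finset.single_le_sum (f := fun x => |c (Λ (ρ x)) + τ p * d (Λ (ρ x)) - (c p + τ p * d p)|)
        (fun x _ => abs_nonneg _) (hS.mem_toFinset.2 hx)
    have h2 : ∑ x ∈ hS.toFinset, |c (Λ (ρ x)) + τ p * d (Λ (ρ x)) - (c p + τ p * d p)| ≤ B :=
      Finset.single_le_sum (f := fun p => ∑ x ∈ hS.toFinset,
          |c (Λ (ρ x)) + τ p * d (Λ (ρ x)) - (c p + τ p * d p)|)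
        (fun p _ => Finset.sum_nonneg fun x _ => abs_nonneg _) (hUfin.mem_toFinset.2 hp)
    have h3 := le_abs_self (c (Λ (ρ x)) + τ p * d (Λ (ρ x)) - (c p + τ p * d p))
    linarith
  let K : ℝ := (B + 1) / γ
  have hK0 : 0 ≤ K := div_nonneg (by linarith) hγ.le
  have hKγ : K * γ = B + 1 := div_mul_cancel₀ _ hγ.ne'
  -- the lifted shadow map and the translation vector
  let L : E →ₗ[ℝ] (Fin 2 → ℝ) := Λ ∘ₗ ρ + (K • w).smulRight e
  let v : Fin 2 → ℝ := (K * w₀) • e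
  have hL : ∀ x, L x = Λ (ρ x) + (K * w x) • e := fun x => by
    simp [L, LinearMap.smulRight_apply, smul_eq_mul]
  have hcL : ∀ x, c (L x) = c (Λ (ρ x)) + K * w x := fun x => by
    rw [hL, map_add, hc, hce, mul_one]
  have hdL : ∀ x, d (L x) = d (Λ (ρ x)) := fun x => by
    rw [hL, map_add, hd, hde, mul_zero, add_zero]
  have hcv : ∀ p : Fin 2 → ℝ, c (p + v) = c p + K * w₀ := fun p => by
    show c (p + (K * w₀) • e) = _; rw [map_add, hc, hce, mul_one]
  have hdv : ∀ p : Fin 2 → ℝ, d (p + v) = d p := fun p => by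
    show d (p + (K * w₀) • e) = _; rw [map_add, hd, hde, mul_zero, add_zero]
  refine ⟨L, v, ?_⟩
  rintro _ ⟨p, hp, rfl⟩
  have hpU : p ∈ U := hp
  obtain ⟨y, hyY, hΛy⟩ := hp.1
  rw [← hY] at hyY
  obtain ⟨x₀, ⟨hx₀S, hx₀face⟩, hρx₀⟩ := hyY
  have hx₀w : w x₀ = w₀ := hx₀face
  refine ⟨⟨x₀, hx₀S, ?_⟩, τ p, fun q hq hne => ?_⟩
  · show L x₀ = p + (K * w₀) • e
    rw [hL, hx₀w, hρx₀, hΛy]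
  · obtain ⟨x, hxS, rfl⟩ := hq
    rw [hcL, hdL, hcv, hdv]
    by_cases hface : w x = w₀
    · have hxY : ρ x ∈ Y := by rw [← hY]; exact ⟨x, ⟨hxS, hface⟩, rfl⟩
      have hq' : Λ (ρ x) ∈ Λ '' Y := ⟨ρ x, hxY, rfl⟩
      have hne' : Λ (ρ x) ≠ p := by
        intro h; apply hne
        show L x = p + (K * w₀) • e
        rw [hL, hface, h]
      have := hτ p hpU _ hq' hne'
      rw [hface]
      linarith
    · have h1 := hw1 x hxS hface
      have h2 := hBbound p hpU x hxS
      have h3 : K * w x + (B + 1) ≤ K * w₀ := by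
        have : K * (w x + γ) ≤ K * w₀ := mul_le_mul_of_nonneg_left h1 hK0
        linarith [mul_add K (w x) γ]
      linarith

/-- coordinate-face special case (T2): face functional `ψ ∈ {0} ∪ [1,∞)` on `S`, face `S ∩ {ψ = 0}`. -/
theorem um_lift {E F : Type*} [AddCommGroup E] [Module ℝ E] [AddCommGroup F] [Module ℝ F]
    (S : Set E) (hS : S.Finite) (ψ : E →ₗ[ℝ] ℝ) (hψS : ∀ x ∈ S, ψ x = 0 ∨ 1 ≤ ψ x)
    (ρ : E →ₗ[ℝ] F) (Y : Set F) (hY : ρ '' (S ∩ {x | ψ x = 0}) = Y)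
    (Λ : F →ₗ[ℝ] (Fin 2 → ℝ)) (c d : (Fin 2 → ℝ) →+ ℝ)
    (hc : ∀ (a : ℝ) (x : Fin 2 → ℝ), c (a • x) = a * c x) (hd : ∀ (a : ℝ) (x : Fin 2 → ℝ), d (a • x) = a * d x)
    (e : Fin 2 → ℝ) (hce : c e = 1) (hde : d e = 0) :
    ∃ (L : E →ₗ[ℝ] (Fin 2 → ℝ)) (v : Fin 2 → ℝ), (fun p => p + v) '' {p | p ∈ Λ '' Y ∧ ∃ t : ℝ, ∀ q ∈ Λ '' Y, q ≠ p → c q + t * d q < c p + t * d p} ⊆ {p | p ∈ L '' S ∧ ∃ t : ℝ, ∀ q ∈ L '' S, q ≠ p → c q + t * d q < c p + t * d p} := by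
  have hwS : ∀ x ∈ S, (-ψ) x = 0 ∨ (-ψ) x + 1 ≤ 0 := fun x hx => by
    rcases hψS x hx with h | h
    · left; simp [h]
    · right; simp only [LinearMap.neg_apply]; linarith
  have hY' : ρ '' (S ∩ {x | (-ψ) x = 0}) = Y := by
    have : {x : E | (-ψ) x = 0} = {x | ψ x = 0} := by ext x; simp
    rw [this]; exact hY
  exact um_lift_face S hS (-ψ) 0 1 one_pos hwS ρ Y hY' Λ c d hc hd e hce hde

/-- corollary: the lifted shadow has at least as many uniquely maximised points as the face shadow's pencil count,
all of them vertices. -/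
theorem ncard_um_le_shadow_lift {E F : Type*} [AddCommGroup E] [Module ℝ E] [AddCommGroup F] [Module ℝ F]
    (S : Set E) (hS : S.Finite) (ψ : E →ₗ[ℝ] ℝ) (hψS : ∀ x ∈ S, ψ x = 0 ∨ 1 ≤ ψ x)
    (ρ : E →ₗ[ℝ] F) (Y : Set F) (hY : ρ '' (S ∩ {x | ψ x = 0}) = Y)
    (Λ : F →ₗ[ℝ] (Fin 2 → ℝ)) (c d : (Fin 2 → ℝ) →+ ℝ)
    (hc : ∀ (a : ℝ) (x : Fin 2 → ℝ), c (a • x) = a * c x) (hd : ∀ (a : ℝ) (x : Fin 2 → ℝ), d (a • x) = a * d x)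
    (e : Fin 2 → ℝ) (hce : c e = 1) (hde : d e = 0) :
    ∃ L : E →ₗ[ℝ] (Fin 2 → ℝ),
      ({p | p ∈ Λ '' Y ∧ ∃ t : ℝ, ∀ q ∈ Λ '' Y, q ≠ p → c q + t * d q < c p + t * d p}).ncard ≤ (Set.extremePoints ℝ (convexHull ℝ (L '' S))).ncard := by
  obtain ⟨L, v, hL⟩ := um_lift S hS ψ hψS ρ Y hY Λ c d hc hd e hce hde
  refine ⟨L, ?_⟩
  rw [← Set.ncard_image_of_injective _ (add_left_injective v)]
  refine Set.ncard_le_ncard (hL.trans (um_subset_extremePoints _ c d hc hd)) ?_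
  exact (hS.image L).subset extremePoints_convexHull_subset

/-- **face-lift count** (vertex currency): if the shadow `Λ(Y)` of the face image has more than `4·B` vertices, some
shadow of `S` has more than `B` vertices. -/
theorem shadow_faceLift_count {E F : Type*} [AddCommGroup E] [Module ℝ E] [AddCommGroup F] [Module ℝ F]
    (S : Set E) (hS : S.Finite) (ψ : E →ₗ[ℝ] ℝ) (hψS : ∀ x ∈ S, ψ x = 0 ∨ 1 ≤ ψ x)
    (ρ : E →ₗ[ℝ] F) (Y : Set F) (hY : ρ '' (S ∩ {x | ψ x = 0}) = Y)
    (Λ : F →ₗ[ℝ] (Fin 2 → ℝ)) (B : ℕ)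
    (hB : 4 * B < (Set.extremePoints ℝ (convexHull ℝ (Λ '' Y))).ncard) :
    ∃ L : E →ₗ[ℝ] (Fin 2 → ℝ), B < (Set.extremePoints ℝ (convexHull ℝ (L '' S))).ncard := by
  have hYfin : Y.Finite := by rw [← hY]; exact (hS.subset Set.inter_subset_left).image _
  obtain ⟨c, d, e, hc, hd, hce, hde, hcount⟩ :=
    exists_pencil_of_many_vertices (Λ '' Y) (hYfin.image Λ) B hB
  obtain ⟨L, hL⟩ := ncard_um_le_shadow_lift S hS ψ hψS ρ Y hY Λ c d hc hd e hce hde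
  exact ⟨L, lt_of_lt_of_le hcount hL⟩

/-- **face-lift count, valid-inequality version** (for G♭ ⇒ G): if the shadow `Λ(Y)` of the read-out of the face
`S ∩ {w = w₀}` (any inequality valid on the finite set `S`) has more than `4·B` vertices, some shadow of `S` has more than `B`. -/
theorem shadow_faceLift_count_face {E F : Type*} [AddCommGroup E] [Module ℝ E] [AddCommGroup F] [Module ℝ F]
    (S : Set E) (hS : S.Finite) (w : E →ₗ[ℝ] ℝ) (w₀ : ℝ) (hvalid : ∀ x ∈ S, w x ≤ w₀)
    (ρ : E →ₗ[ℝ] F) (Y : Set F) (hY : ρ '' (S ∩ {x | w x = w₀}) = Y)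
    (Λ : F →ₗ[ℝ] (Fin 2 → ℝ)) (B : ℕ)
    (hB : 4 * B < (Set.extremePoints ℝ (convexHull ℝ (Λ '' Y))).ncard) :
    ∃ L : E →ₗ[ℝ] (Fin 2 → ℝ), B < (Set.extremePoints ℝ (convexHull ℝ (L '' S))).ncard := by
  have hYfin : Y.Finite := by rw [← hY]; exact (hS.subset Set.inter_subset_left).image _
  obtain ⟨c, d, e, hc, hd, hce, hde, hcount⟩ :=
    exists_pencil_of_many_vertices (Λ '' Y) (hYfin.image Λ) B hB
  obtain ⟨γ, hγ, hwS⟩ := exists_face_gap S hS w w₀ hvalid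
  obtain ⟨L, v, hL⟩ := um_lift_face S hS w w₀ γ hγ hwS ρ Y hY Λ c d hc hd e hce hde
  refine ⟨L, lt_of_lt_of_le hcount ?_⟩
  rw [← Set.ncard_image_of_injective _ (add_left_injective v)]
  refine Set.ncard_le_ncard (hL.trans (um_subset_extremePoints _ c d hc hd)) ?_
  exact (hS.image L).subset extremePoints_convexHull_subset

end GridCorShadow

end Summit.ValiantsHypothesis.ValiantsHypothesis.Theorems.FifoMatching
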